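import Mathlib.Combinatorics.SetFamily.Compression.Down
import Mathlib.Tactic
import HarnessLib
import HarnessLib.Audit.Tags
import Summits.CriticalPhenomena.PercolationContinuityZ3.Theorems.PercNearOneGluingNoHeavyLowerTailSahiRainbowTwoColourSparse
import Summits.CriticalPhenomena.PercolationContinuityZ3.Theorems.PercNearOneGluingNoHeavyLowerTailSahiRainbowTwoColourEquiv

/-!
# The two-colouring statement compresses, III: the residual as a TWIN-POINT statement

Support file (seat `prim-masterthm-p1`, gen 41; `--supports stmt-CriticalPhenomena-4575`).  No `sorry`, standard axioms.
Companion of `…SahiRainbowTwoColourSparse` (`SparseTwoColourMeets ⟹ TwoColourMeets ⟹ RainbowMeetCojoin`).  Memo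
`run/shared/lean/prim/prim-masterthm/FROM-prim-masterthm-p1-g41-TWO-COLOUR.md` §3, §6.

The sparse residual asks for the two-colouring inequality on configurations `Z = X ⊔ Y ⊆ 2^G` (complement-closed) with one or two
doubled antipodal pairs at EVERY point (`0 < #D_y < 6`, `D_y = bothLifts Z y`).  At such a point the monochromatic meets of the
upper-coloured doubled configuration give `#twins ≥ #D_y / 2 - 1` for free (a four-set case analysis), so ONE further twin at ONE point
closes the induction (`card_le_two_mul_card_monoMeets_of_twinPoint`).  This file records that form in the kernel:

* `SparseTwinPoint` (typed, [status: open]) — every sparse configuration with `#Z ≥ 10` has a point `y` with `#D_y ≤ 2 · #twins_y`.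
  EVIDENCE (`prim-masterthm-p1/code-g41/c/deficit.c`, a complete backtracking search over ALL 2-coloured complement-closed families
  with the pruning "no hypercube edge between non-empty colours"): **no counterexample on ground sets of size ≤ 6** (complete;
  n = 6: 1.5·10⁷ nodes, 3 s), n = 7 running (kit j303006); exhaustive sparse census on 5 points (`allbad5.c`); tight (equality at every
  point) on `{∅} ∪ {G∖y} ∪ matching`.  Equivalently (averaging, since `#twins_y ≥ #D_y/2 − 1` pointwise): the colour set spans at least
  `Σ_y (p_y − 1) + 1` hypercube edges.
* `SmallTwoColourMeets` (typed, [status: verified by computation, not in the kernel]) — the two-colouring inequality for `#Z ∈ {6, 8}`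
  (three or four antipodal pairs), for EVERY ground set.  `prim-masterthm-p1/code-g41/c/atoms.c` verifies it dimension-free: a
  configuration with `m` pairs is determined, for counting distinct meets, by its set of non-empty atoms `T ⊆ {0,1}^m` and its
  colouring; all `12 096` (m = 3) and `16 125 696` (m = 4) instances satisfy `#monoMeets ≥ m` (minimum exactly `m`).
* `twoColourWeakOn_and_rainbowStrictOn_of_twinPoint`, `twoColourMeets_of_twinPoint`, `rainbowMeetCojoin_of_twinPoint` —
  **`SparseTwinPoint ∧ SmallTwoColourMeets ⟹ TwoColourMeets ⟹ RainbowMeetCojoin`** (the induction of the companion file with the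
  twin-point step in the sparse branch).
HONEST FRAMING: `SparseTwinPoint`, `TwoColourMeets`, `RainbowMeetCojoin` remain OPEN; `SmallTwoColourMeets` is machine-checked outside the
kernel only. [this work]
-/

namespace Summit.CriticalPhenomena.PercolationContinuityZ3.Theorems.SahiColouredDaykin

open Finset
open scoped FinsetFamily

variable {α : Type*} [DecidableEq α]

/-- **CONJECTURE (twin point; typed).**  Every SPARSE 2-coloured complement-closed family (`0 < #D_y < 6` at every point) with at
least five antipodal pairs has a point `y` at which the doubled members are paid by twins: `#D_y ≤ 2 · #twins_y`.
Complete computer verification for ground sets of size ≤ 6 (file header). [this work] [status: open] -/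
@[conjecture] def SparseTwinPoint (α : Type*) [DecidableEq α] : Prop :=
  ∀ (G : Finset α) (X Y : Finset (Finset α)),
    (∀ z ∈ X ∪ Y, z ⊆ G) → (∀ z ∈ X ∪ Y, G \ z ∈ X ∪ Y) → Disjoint X Y → 10 ≤ #(X ∪ Y) →
    (∀ y ∈ G, 0 < #(bothLifts (X ∪ Y) y) ∧ #(bothLifts (X ∪ Y) y) < 6) →
    ∃ y ∈ G, #(bothLifts (X ∪ Y) y) ≤ 2 * #(bothLifts (monoMeets X Y) y)

/-- **STATEMENT (three or four antipodal pairs; typed).**  The two-colouring inequality for `#Z ∈ {6, 8}` on every ground set.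
Verified dimension-free by the atom-pattern computation `prim-masterthm-p1/code-g41/c/atoms.c` (all `T ⊆ {0,1}^m`, all
colourings, `m = 3, 4`; minimum `#monoMeets = m`); not yet replayed in the kernel. [this work] [status: open] -/
@[conjecture] def SmallTwoColourMeets (α : Type*) [DecidableEq α] : Prop :=
  ∀ (G : Finset α) (X Y : Finset (Finset α)),
    (∀ z ∈ X ∪ Y, z ⊆ G) → (∀ z ∈ X ∪ Y, G \ z ∈ X ∪ Y) → Disjoint X Y → 6 ≤ #(X ∪ Y) → #(X ∪ Y) < 10 →
    #(X ∪ Y) ≤ 2 * #(monoMeets X Y)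

omit [DecidableEq α] in
/-- A family of subsets of `G` has at most `2 ^ #G` members. [this work] -/
theorem card_le_two_pow_card {G : Finset α} {Z : Finset (Finset α)} (hZG : ∀ z ∈ Z, z ⊆ G) : #Z ≤ 2 ^ #G := by
  rw [← card_powerset]
  exact card_le_card fun z hz => mem_powerset.2 (hZG z hz)

/-- The doubled family at `y` has even size (it is complement-closed in the nonempty `G.erase y`). [this work] -/
theorem even_card_bothLifts {G : Finset α} {X Y : Finset (Finset α)} {y : α} (hy : y ∈ G) (hZG : ∀ z ∈ X ∪ Y, z ⊆ G)
    (hcc : ∀ z ∈ X ∪ Y, G \ z ∈ X ∪ Y) (hXY : Disjoint X Y) (hG : (G.erase y).Nonempty) :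
    ∃ U : Finset (Finset α), #(bothLifts (X ∪ Y) y) = 2 * #U := by
  obtain ⟨hDG, hDcc, -⟩ := upperClass_config hy hZG hcc hXY
  rw [upperClass_union] at hDG hDcc
  obtain ⟨U, hU, hUcf, hDeq⟩ := exists_half_of_closed hG (bothLifts (X ∪ Y) y) hDG hDcc
  refine ⟨U, ?_⟩
  rw [hDeq]
  exact card_union_image_sdiff (fun u hu => hDG u (hU hu)) hUcf

/-- **The induction with the twin-point step.**  Under `SparseTwinPoint` and `SmallTwoColourMeets`, every ground set satisfies the
weak two-colouring statement and the strict rainbow form. [this work] -/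
theorem twoColourWeakOn_and_rainbowStrictOn_of_twinPoint (hT : SparseTwinPoint α) (hS : SmallTwoColourMeets α)
    (G : Finset α) : TwoColourWeakOn G ∧ RainbowStrictOn G := by
  induction' hn : #G using Nat.strong_induction_on with n ihn generalizing G
  have IH : ∀ y ∈ G, TwoColourWeakOn (G.erase y) ∧ RainbowStrictOn (G.erase y) := fun y hy =>
    ihn #(G.erase y) (by rw [← hn]; exact card_erase_lt_of_mem hy) (G.erase y) rfl
  have weak : TwoColourWeakOn G := by
    intro X Y hZG hcc hXY h6
    by_cases hgood : ∃ y ∈ G, #(bothLifts (X ∪ Y) y) = 0 ∨ 6 ≤ #(bothLifts (X ∪ Y) y)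
    · obtain ⟨y, hy, hgood⟩ := hgood
      exact card_le_two_mul_card_monoMeets_of_good hy hZG hcc hXY h6 (IH y hy).1 (IH y hy).2 hgood
    · push Not at hgood
      have hsparse : ∀ y ∈ G, 0 < #(bothLifts (X ∪ Y) y) ∧ #(bothLifts (X ∪ Y) y) < 6 := fun y hy => by
        have := hgood y hy; omega
      by_cases h10 : 10 ≤ #(X ∪ Y)
      · obtain ⟨y, hy, htw⟩ := hT G X Y hZG hcc hXY h10 hsparse
        have hlt := (hsparse y hy).2
        -- `#D_y` is even, hence `≤ 4`, so the projected configuration has at least six members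
        have hG : (G.erase y).Nonempty := by
          rw [← card_pos, card_erase_of_mem hy]
          by_contra hle
          push Not at hle
          have hG1 : #G ≤ 1 := by omega
          have := card_le_two_pow_card hZG
          have h2 : 2 ^ #G ≤ 2 ^ 1 := Nat.pow_le_pow_right (by norm_num) hG1
          omega
        obtain ⟨U, hU⟩ := even_card_bothLifts hy hZG hcc hXY hG
        exact card_le_two_mul_card_monoMeets_of_twinPoint hZG hcc (by omega) (IH y hy).1 htw
      · exact hS G X Y hZG hcc hXY h6 (by omega)
  refine ⟨weak, ?_⟩
  intro 𝒞 h𝒞G hcf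
  refine ⟨card_le_card_rainbowMeets_of_twoColourWeakOn weak h𝒞G hcf, fun h2 hnd => ?_⟩
  have hGne : G.Nonempty := by
    rw [nonempty_iff_ne_empty]; rintro rfl
    obtain ⟨c, hc, d, hd, hcd⟩ := one_lt_card.1 h2
    exact hcd ((subset_empty.1 (h𝒞G c hc)).trans (subset_empty.1 (h𝒞G d hd)).symm)
  obtain ⟨r, hr⟩ := hGne
  exact card_add_one_le_card_rainbowMeets_of_not_degenerate hr h𝒞G hcf h2 hnd (IH r hr).2

/-- **`SparseTwinPoint ∧ SmallTwoColourMeets ⟹ TwoColourMeets`.** [this work] -/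
theorem twoColourMeets_of_twinPoint (hT : SparseTwinPoint α) (hS : SmallTwoColourMeets α) : TwoColourMeets α :=
  fun G X Y hZG hcc hXY h6 => (twoColourWeakOn_and_rainbowStrictOn_of_twinPoint hT hS G).1 X Y hZG hcc hXY h6

/-- **`SparseTwinPoint ∧ SmallTwoColourMeets ⟹ SparseTwoColourMeets`** (so the twin-point statement refines the sparse residual).
[this work] -/
theorem sparseTwoColourMeets_of_twinPoint (hT : SparseTwinPoint α) (hS : SmallTwoColourMeets α) :
    SparseTwoColourMeets α :=
  fun G X Y hZG hcc hXY h6 _ => twoColourMeets_of_twinPoint hT hS G X Y hZG hcc hXY h6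

/-- **`SparseTwinPoint ∧ SmallTwoColourMeets ⟹ RainbowStrict`.** [this work] -/
theorem rainbowStrict_of_twinPoint (hT : SparseTwinPoint α) (hS : SmallTwoColourMeets α) : RainbowStrict α :=
  fun G => (twoColourWeakOn_and_rainbowStrictOn_of_twinPoint hT hS G).2

/-- **`SparseTwinPoint ∧ SmallTwoColourMeets ⟹ RainbowMeetCojoin`**: the rainbow lemma follows from one twin point in every
sparse configuration (plus the machine-checked cases of three and four antipodal pairs). [this work] -/
theorem rainbowMeetCojoin_of_twinPoint (hT : SparseTwinPoint α) (hS : SmallTwoColourMeets α) : RainbowMeetCojoin α :=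
  rainbowMeetCojoin_of_twoColourMeets (twoColourMeets_of_twinPoint hT hS)

end Summit.CriticalPhenomena.PercolationContinuityZ3.Theorems.SahiColouredDaykin
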